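import Literature.MathematicalPhysics.QuantumFieldTheory.Balaban1983to89.B9ThmDCommutatorStep
import Literature.MathematicalPhysics.QuantumFieldTheory.Balaban1983to89.B9Thm39CinvUpperL

/-!
# `Balaban1983to89.B9ThmDCubeSideKernels` — THEOREM D FOR THE RECORD'S LETTERS, FILE D4: THE CUBE-SIDE KERNELS OF THE THREE TERMS OF FILE D1 OVER THE CUBE
# SEQUENCE'S BLOCKS, WITH THE `M`-GAP OF PRINT p. 412 CARRIED BY THE TRANSITION INDICATOR (sub-row G-B9-LETTERS, GAPS G-B9-05, file D4)

T. Bałaban, *Propagators for lattice gauge theories in a background field*, Commun. Math. Phys. **99** (1985) 389–434 [`Balaban1985BackgroundPropagators`, "[B9]"];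
[4] = T. Bałaban, *Propagators and renormalization transformations for lattice gauge theories. II*, Commun. Math. Phys. **96** (1984) 223–250 [`Balaban1984PropagatorsII`];
[2] of [B9] = T. Bałaban, *Regularity and decay of lattice Green's functions*, Commun. Math. Phys. **89** (1983) 571–597 [`Balaban1983RegularityDecay`].

statement-level skeleton of published theorems with citation tags; proofs where landed; nothing here is a claim about the Yang–Mills mass gap

THE PRINT (held `paper:balaban1985-cmp99-background-propagators`, journal page = PDF page + 388).  p. 412 l. 1–9 (Theorem D paragraph): *«the operators may differ outside
□̃₀, and the distance from □̃ to □̃₀ᶜ is at least M (on L⁻ʲ-scale)»*; (3.89) p. 409; [4] (2.52)/(2.60)–(2.61) pp. 232–234 (composition of block majorants, scale transfer,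
Lemma 2.1).  LABELLED DEVIATION (lead GO 15:21Z (b); files D1/D3): Theorem D is obtained here WITHOUT [2]'s second random-walk expansion ([2] Sect. 5 (5.8) p. 594,
(5.17)–(5.22) pp. 596–597): the `M`-gap enters through the SUPPORT of the commutator step — the rows of `R_χ = [M_χ, Δ′_{a,□}(Ṽ)]G′_□(Ṽ)` and the multiplier `1 − χ_□²`
live in the transition annulus `¬NearC(3S_j − L^{j+1})`, while `□̃ ⊂ NearC 2S_j` (file D2); the cube sequence's block distance between the two is `≥ M_h/2`
(p21's `sub_le_dist_mul_of_nearC`).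

WHAT THIS FILE PROVES (two indicator `def`s of reals — `transInd` (transition blocks), `nearInd` (blocks meeting `NearC 2S_j`) — and THEOREMS; 0 `def … : Prop`; 0 sorry).
* §1 ★ `gap_dist_of_near_of_trans` — `M_h/2 ≤ d_□(Δ_□(x), Δ_□(z))` for `x ∈ NearC 2S_j`, `z ∉ NearC(3S_j − L^{j+1})`; `scaleTransfer_const`.
* §2 ★ `hasMajorant_conj_commStep_trans` — the commutator step's majorant carries the row indicator: `conj b(R_χ) ≺ θ·1_T(a)·e^{−δd}`.
* §3 ★ `hasMajorant_commStep_mul_G` — `conj b(R_χ·η²G′_□) ≺ θB_fL⁴c₁·1_T(a)ℓ(a)²·e^{−(1−α′)(1−a₀)δd}` ([4] (2.52) with the scale transfer of `ℓ²`).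
* §4 ★ `hasMajorant_G_oneSubSq` (`conj b(η²G′_□·(1 − M_χ²)) ≺ B_fM₂Σ‖b‖·ℓ(a)²·1_T(a′)e^{−δd}`, the indicator on the SOURCE), ★ `kernel_gap_fold` (`1_T(a′)e^{−(δ/2)d(a,a′)} ≤ Ψ(a)`,
  `Ψ = e^{−δM_h/4}` on near blocks, `1` elsewhere), ★★ `hasMajorant_G_oneSubSq_G` — `conj b(η²G′(1 − M_χ²)η²G′) ≺ B_f²M₂Σ‖b‖L⁴c₁·ℓ(a)⁴Ψ(a)·e^{−(1−α′)(1−a₀)(δ/2)d}`.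

HONEST SCOPE.  Lattice units; `𝔸` a complete normed `ℂ`-algebra, real basis `b` (coordinate bound `M₂`); `V`, `par` arbitrary; the (3.42) entries and the commutator
step's majorant are HYPOTHESES (p33 7b-C, file D3); (2.61) and the scale transfer over `geoCK` are hypotheses (p33 `exists_h261_geoCK`, `hST_geoCK`).  Count-neutral;
nothing continuum, nothing about OS axioms or the mass gap.  No `sorry`, no `axiom`, no `instance`, no `notation`.  NEW file.  Net new unproved facts: 0.
Seat `lit-balaban-p21` gen 35, 2026-08-28; `--supports stmt-QuantumFields-19200`.
-/

noncomputable section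

namespace Literature.MathematicalPhysics.QuantumFieldTheory.Balaban1983to89.B9ThmDCubeSideKernels

open B6RandomWalk (HasMajorant BlockSupp hasMajorant_mono hasMajorant_mul Triangle254 Ineq261 c1_nonneg)
open B9Thm34Ext (toB6)
open B9Ineq347 (ScaleTransfer)
open B6KLevelCensusIndexV1 (KIdx kGeo)
open B6Cover236MultiLevelBlocks (cubes)
open B6Geom246MultiLevelBox (blkOf)
open B9Eq352DivFormLetters (conj conj_apply coordEquiv)
open B9Eq39Adjoint (R)
open B9Eq360DeltaPrimeACubeY (blkCubeY)
open B9CubeLettersOpsL0 (deltaPrimeACubeY GpCubeY)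
open B9CubeLettersBondOpsL0 (BlkCubeY)
open B9CubeGeometryInputs (geoCK geoCK_eta geoCK_eta_pos geoCK_len_pos geoCK_dist_axioms geoCK_len_blkCubeY)
open B9Cor36CubeTwinsGeometry (bS one_le_bS eight_mul_bS_le_SC SC_eq sub_le_dist_mul_of_nearC)
open B9Cor36CubeCutoffs (SC NearC chiY chiY_eq_one_of_nearC one_le_SC abs_chiY_le_one)
open B9Cor36SiteSandwichTransfer (hasMajorant_mul_of_rowLocal_right rowLocal_conj_of_local)
open B9Thm37CubeCoverCommutators (cutMulY cutMulY_apply)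
open B9Thm37CubeCoverCommutatorSizes (norm_ofReal_smul)
open B9Thm39CinvUpperL (hasMajorant_mul_weighted)
open B9ThmDCommutatorStep (commStep_apply_eq_zero_of_nearC)
open Node00 (SiteY CfgY SiteParY toKT)

variable {d ℓ : ℕ} {hd : 1 ≤ d + 1} {hL : Odd (ℓ + 1) ∧ 1 < ℓ + 1} {b₀ b₁ : ℝ}
variable {𝔸 : Type} [NormedRing 𝔸] [NormedAlgebra ℂ 𝔸] [CompleteSpace 𝔸]
variable {ι : Type} [Fintype ι]
variable (i : KIdx d ℓ hd hL b₀ b₁) (c : ↥(cubes (toKT i).D.toDomains))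

/-! ## §1 The transition indicator, the near indicator, and the `M`-gap between them -/

open Classical in
/-- **`1_T`**: the indicator of the cube-sequence blocks meeting the transition annulus `¬NearC(3S_j − L^{j+1})` (where the rows of `R_χ` and the multiplier `1 − χ_□²` live).
[cite: Balaban1985BackgroundPropagators, p.412 l.1–9 («the operators may differ outside □̃₀»), (3.88) p.409] -/
def transInd (s : BlkCubeY i c) : ℝ := if ∃ z : SiteY i, blkCubeY i c z = s ∧ ¬ NearC i c (3 * SC i c - (bS i c : ℤ)) z.1 then 1 else 0

open Classical in
/-- **`1_N`**: the indicator of the cube-sequence blocks meeting `NearC 2S_j ⊇ □̃`. [cite: Balaban1985BackgroundPropagators, (3.95) p.411 («□̃»), p.412 l.1–9] -/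
def nearInd (s : BlkCubeY i c) : ℝ := if ∃ x : SiteY i, blkCubeY i c x = s ∧ NearC i c (2 * SC i c) x.1 then 1 else 0

/-- `1_T ∈ {0, 1}`, so `0 ≤ 1_T ≤ 1`. [cite: Balaban1985BackgroundPropagators, p.412, bookkeeping] -/
theorem transInd_nonneg_le_one (s : BlkCubeY i c) : 0 ≤ transInd i c s ∧ transInd i c s ≤ 1 := by
  unfold transInd; split_ifs <;> norm_num

/-- `0 ≤ 1_N ≤ 1`. [cite: Balaban1985BackgroundPropagators, p.412, bookkeeping] -/
theorem nearInd_nonneg_le_one (s : BlkCubeY i c) : 0 ≤ nearInd i c s ∧ nearInd i c s ≤ 1 := by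
  unfold nearInd; split_ifs <;> norm_num

/-- `1_T(Δ_□(z)) = 1` off the plateau. [cite: Balaban1985BackgroundPropagators, p.412, bookkeeping] -/
theorem transInd_eq_one {z : SiteY i} (hz : ¬ NearC i c (3 * SC i c - (bS i c : ℤ)) z.1) : transInd i c (blkCubeY i c z) = 1 := by
  unfold transInd; rw [if_pos ⟨z, rfl, hz⟩]

/-- `1_N(Δ_□(x)) = 1` for `x ∈ NearC 2S_j`. [cite: Balaban1985BackgroundPropagators, p.412, bookkeeping] -/
theorem nearInd_eq_one {x : SiteY i} (hx : NearC i c (2 * SC i c) x.1) : nearInd i c (blkCubeY i c x) = 1 := by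
  unfold nearInd; rw [if_pos ⟨x, rfl, hx⟩]

/-- ★ **THE `M`-GAP** (print p. 412: «the distance from □̃ to □̃₀ᶜ is at least M»): a block meeting `NearC 2S_j` and a block meeting the transition annulus are at
cube-sequence block distance `≥ M_h/2` (`S_j = M_hL^{j+1}`, `M_h ≥ 8`). [cite: Balaban1985BackgroundPropagators, p.412 l.1–9, (3.95) p.411; Balaban1984PropagatorsII, (2.46) p.231] -/
theorem gap_dist_of_near_of_trans {s y : BlkCubeY i c} (hs : nearInd i c s = 1) (hy : transInd i c y = 1) :
    ((toKT i).Mh : ℝ) / 2 ≤ (geoCK i c).dist s y := by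
  classical
  have hs' : ∃ x : SiteY i, blkCubeY i c x = s ∧ NearC i c (2 * SC i c) x.1 := by
    by_contra h; unfold nearInd at hs; rw [if_neg h] at hs; norm_num at hs
  have hy' : ∃ z : SiteY i, blkCubeY i c z = y ∧ ¬ NearC i c (3 * SC i c - (bS i c : ℤ)) z.1 := by
    by_contra h; unfold transInd at hy; rw [if_neg h] at hy; norm_num at hy
  obtain ⟨x, hxs, hx⟩ := hs'
  obtain ⟨z, hzy, hz⟩ := hy'
  have h := sub_le_dist_mul_of_nearC i c hxs hzy hx hz
  have hS := SC_eq i c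
  have h8 : (8 : ℝ) ≤ ((toKT i).Mh : ℝ) := by exact_mod_cast i.hM8
  have hb : (1 : ℝ) ≤ ((bS i c : ℕ) : ℝ) := by exact_mod_cast one_le_bS i c
  have hcast : (((3 * SC i c - (bS i c : ℤ) - 2 * SC i c - (bS i c : ℤ) + 2 : ℤ)) : ℝ) = (((toKT i).Mh : ℝ) - 2) * ((bS i c : ℕ) : ℝ) + 2 := by
    rw [hS]; push_cast; ring
  rw [hcast] at h
  have hd0 := (geoCK_dist_axioms i c (0 : ℝ) True).1 s y
  nlinarith

/-- the scale transfer of a CONSTANT weight is free (`C = 1`, any `α ≥ 0`, `δ ≥ 0`). [cite: Balaban1984PropagatorsII, (2.60) p.234, bookkeeping] -/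
theorem scaleTransfer_const {δ α : ℝ} (hα : 0 ≤ α * δ) : ScaleTransfer (geoCK i c) δ α 1 (fun _ => (1 : ℝ)) := by
  intro y y'
  have hd0 := (geoCK_dist_axioms i c (0 : ℝ) True).1 y y'
  rw [mul_one, one_mul]
  exact Real.exp_le_one_iff.mpr (by nlinarith)

/-! ## §2 The commutator step's majorant carries the transition indicator on its row -/

section Kernels

variable (b : Module.Basis ι ℝ 𝔸)

/-- ★ **`conj b(R_χ) ≺ θ·1_T(a)·e^{−δd}`**: the rows of `R_χ` inside the plateau vanish (file D3), so the row indicator costs nothing. [cite: Balaban1985BackgroundPropagators, p.412 l.1–9, (3.89) p.409] -/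
theorem hasMajorant_conj_commStep_trans (Rr : ℝ) (H : Prop) (par : SiteParY 𝔸 i) (V : CfgY 𝔸 i) {θ δ : ℝ} (hθ : 0 ≤ θ)
    (hR : HasMajorant (g := toB6 (geoCK i c) Rr H) (fun p : SiteY i × ι => blkCubeY i c p.1)
      (conj b (((cutMulY (chiY i c) * deltaPrimeACubeY i c par V - deltaPrimeACubeY i c par V * cutMulY (chiY i c)) * GpCubeY i c par V).restrictScalars ℝ))
      (fun a a' => θ * Real.exp (-(δ * (geoCK i c).dist a a')))) :
    HasMajorant (g := toB6 (geoCK i c) Rr H) (fun p : SiteY i × ι => blkCubeY i c p.1)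
      (conj b (((cutMulY (chiY i c) * deltaPrimeACubeY i c par V - deltaPrimeACubeY i c par V * cutMulY (chiY i c)) * GpCubeY i c par V).restrictScalars ℝ))
      (fun a a' => θ * transInd i c a * Real.exp (-(δ * (geoCK i c).dist a a'))) := by
  intro y' μ B hμ p
  by_cases hz : NearC i c (3 * SC i c - (bS i c : ℤ)) p.1.1
  · rw [conj_apply, LinearMap.restrictScalars_apply, commStep_apply_eq_zero_of_nearC i c par V _ hz, map_zero, Finsupp.zero_apply, abs_zero]
    exact mul_nonneg (mul_nonneg (mul_nonneg hθ (transInd_nonneg_le_one i c _).1) (Real.exp_nonneg _)) hμ.nonneg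
  · have h := hR y' μ B hμ p
    simp only at h ⊢
    rw [transInd_eq_one i c hz, mul_one]
    exact h

/-! ## §3 `R_χ·η²G′_□`: composition with the scale transfer of `ℓ²` ([4] (2.52), (2.60)–(2.61)) -/

/-- ★ **`conj b(R_χ·η²G′_□(V)) ≺ θB_fCc₁·1_T(a)ℓ(a)²·e^{−(1−α′)(1−a₀)δd}`** — the row indicator rides on the left factor's row weight (no transfer), `ℓ²` of `G′` is transferred.
[cite: Balaban1984PropagatorsII, (2.52) p.232, (2.60)–(2.61) p.234; Balaban1985BackgroundPropagators, p.412 l.1–9, (3.89) p.409, (3.42) p.397] -/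
theorem hasMajorant_commStep_mul_G (Rr : ℝ) (H : Prop) (par : SiteParY 𝔸 i) (V : CfgY 𝔸 i) {θ δ Bf a₀ α' C : ℝ} (dB : ℕ)
    (hθ : 0 ≤ θ) (hBf : 0 ≤ Bf) (hC : 0 ≤ C) (ha₀ : 0 ≤ a₀ * δ) (hα'0 : 0 ≤ α') (hα'1 : α' ≤ 1) (hδ' : 0 ≤ (1 - a₀) * δ)
    (hST : ScaleTransfer (geoCK i c) δ a₀ C (fun a => (geoCK i c).len a ^ 2)) (h261 : Ineq261 dB (toB6 (geoCK i c) Rr H) ((1 - a₀) * δ) α')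
    (hR : HasMajorant (g := toB6 (geoCK i c) Rr H) (fun p : SiteY i × ι => blkCubeY i c p.1)
      (conj b (((cutMulY (chiY i c) * deltaPrimeACubeY i c par V - deltaPrimeACubeY i c par V * cutMulY (chiY i c)) * GpCubeY i c par V).restrictScalars ℝ))
      (fun a a' => θ * Real.exp (-(δ * (geoCK i c).dist a a'))))
    (hG : HasMajorant (g := toB6 (geoCK i c) Rr H) (fun p : SiteY i × ι => blkCubeY i c p.1)
      (conj b (((kGeo i).eta ^ 2) • (GpCubeY i c par V).restrictScalars ℝ))
      (fun a a' => Bf * (geoCK i c).len a ^ 2 * Real.exp (-(δ * (geoCK i c).dist a a')))) :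
    HasMajorant (g := toB6 (geoCK i c) Rr H) (fun p : SiteY i × ι => blkCubeY i c p.1)
      (conj b (((cutMulY (chiY i c) * deltaPrimeACubeY i c par V - deltaPrimeACubeY i c par V * cutMulY (chiY i c)) * GpCubeY i c par V).restrictScalars ℝ *
        (((kGeo i).eta ^ 2) • (GpCubeY i c par V).restrictScalars ℝ)))
      (fun a a' => θ * Bf * C * B6.c1 dB ((1 - a₀) * δ) α' * (transInd i c a * (geoCK i c).len a ^ 2) *
        Real.exp (-((1 - α') * ((1 - a₀) * δ) * (geoCK i c).dist a a'))) := by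
  obtain ⟨hdnn, htri, -, -⟩ := geoCK_dist_axioms i c Rr H
  have h1 := hasMajorant_conj_commStep_trans i c b Rr H par V hθ hR
  rw [B9Eq352DivFormLetters.conj_mul]
  exact hasMajorant_mul_weighted (g := geoCK i c) (R := Rr) (H := H) (fun p : SiteY i × ι => blkCubeY i c p.1) dB (transInd i c)
    (fun a => (geoCK i c).len a ^ 2) hθ hBf hC (fun a => (transInd_nonneg_le_one i c a).1) (fun a => sq_nonneg _) ha₀ hα'0 hα'1 hδ' htri hdnn hST h261 h1 hG

/-! ## §4 `η²G′_□·(1 − M_χ²)·η²G′_□`: the indicator of the middle block folded into a row weight by the `M`-gap -/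

omit [CompleteSpace 𝔸] in
/-- `(1 − M_χM_χ)f = (1 − χ²)•f` pointwise, and `|1 − χ_□(x)²| ≤ 1_T(Δ_□x)` (`χ_□ = 1` on the plateau, `|χ_□| ≤ 1`). [cite: Balaban1985BackgroundPropagators, Cor. 3.6 p.408; Balaban1984PropagatorsI, (1.118) p.36] -/
theorem norm_oneSubSq_apply_le [CompleteSpace 𝔸] (f : SiteY i → 𝔸) (x : SiteY i) (Bf : ℝ) (hBf : ∀ x', blkCubeY i c x' = blkCubeY i c x → ‖f x'‖ ≤ Bf) :
    ‖((1 - cutMulY (chiY i c) * cutMulY (chiY i c) : Module.End ℂ (SiteY i → 𝔸)).restrictScalars ℝ) f x‖ ≤ transInd i c (blkCubeY i c x) * Bf := by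
  have hB0 : 0 ≤ Bf := (norm_nonneg _).trans (hBf x rfl)
  have e : ((1 - cutMulY (chiY i c) * cutMulY (chiY i c) : Module.End ℂ (SiteY i → 𝔸)).restrictScalars ℝ) f x =
      (((1 - chiY i c x * chiY i c x : ℝ)) : ℂ) • f x := by
    rw [LinearMap.restrictScalars_apply, LinearMap.sub_apply, Pi.sub_apply, Module.End.one_apply, Module.End.mul_apply, cutMulY_apply, cutMulY_apply,
      smul_smul, ← Complex.ofReal_mul, Complex.ofReal_sub, Complex.ofReal_one, sub_smul, one_smul]
  rw [e, norm_ofReal_smul]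
  by_cases hz : NearC i c (3 * SC i c - (bS i c : ℤ)) x.1
  · have h8 := eight_mul_bS_le_SC i c
    have hb' : (1 : ℤ) ≤ (bS i c : ℤ) := by exact_mod_cast one_le_bS i c
    rw [chiY_eq_one_of_nearC i c (by linarith) hz]
    norm_num
    exact mul_nonneg (transInd_nonneg_le_one i c _).1 hB0
  · rw [transInd_eq_one i c hz]
    have hχ := (abs_chiY_le_one i c x).1
    have hsq : |1 - chiY i c x * chiY i c x| ≤ 1 := by
      rw [abs_le] at hχ ⊢
      constructor <;> nlinarith [hχ.1, hχ.2]
    exact mul_le_mul hsq (hBf x rfl) (norm_nonneg _) zero_le_one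

/-- ★ **`conj b(η²G′_□·(1 − M_χ²)) ≺ B_fM₂Σ‖b‖·ℓ(a)²e^{−δd(a,a′)}·1_T(a′)`** — the right factor is row-local with coefficient `1_T` (p33's `hasMajorant_mul_of_rowLocal_right`).
[cite: Balaban1984PropagatorsII, (2.52) p.232 («a block-diagonal factor»); Balaban1985BackgroundPropagators, p.412 l.1–9] -/
theorem hasMajorant_G_oneSubSq (Rr : ℝ) (H : Prop) (par : SiteParY 𝔸 i) (V : CfgY 𝔸 i) {M₂ : ℝ} (hM₂ : 0 ≤ M₂)
    (hrepr : ∀ (v : 𝔸) (j : ι), |b.repr v j| ≤ M₂ * ‖v‖) {δ Bf : ℝ}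
    (hG : HasMajorant (g := toB6 (geoCK i c) Rr H) (fun p : SiteY i × ι => blkCubeY i c p.1)
      (conj b (((kGeo i).eta ^ 2) • (GpCubeY i c par V).restrictScalars ℝ))
      (fun a a' => Bf * (geoCK i c).len a ^ 2 * Real.exp (-(δ * (geoCK i c).dist a a')))) :
    HasMajorant (g := toB6 (geoCK i c) Rr H) (fun p : SiteY i × ι => blkCubeY i c p.1)
      (conj b ((((kGeo i).eta ^ 2) • (GpCubeY i c par V).restrictScalars ℝ) *
        ((1 - cutMulY (chiY i c) * cutMulY (chiY i c) : Module.End ℂ (SiteY i → 𝔸)).restrictScalars ℝ)))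
      (fun a a' => Bf * (geoCK i c).len a ^ 2 * Real.exp (-(δ * (geoCK i c).dist a a')) * (transInd i c a' * (M₂ * ∑ j, ‖b j‖))) := by
  have hSb : 0 ≤ ∑ j, ‖b j‖ := Finset.sum_nonneg fun _ _ => norm_nonneg _
  rw [B9Eq352DivFormLetters.conj_mul]
  exact hasMajorant_mul_of_rowLocal_right (g := toB6 (geoCK i c) Rr H) (fun p : SiteY i × ι => blkCubeY i c p.1)
    (fun a => transInd i c a * (M₂ * ∑ j, ‖b j‖)) (fun a => mul_nonneg (transInd_nonneg_le_one i c a).1 (mul_nonneg hM₂ hSb))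
    (rowLocal_conj_of_local b (blkCubeY i c) (transInd i c) hM₂ hrepr _ fun f x Bf' hBf' => norm_oneSubSq_apply_le i c f x Bf' hBf') hG

/-- **the gap weight `Ψ_ρ`**: `e^{−ρM_h/2}` on the blocks meeting `NearC 2S_j`, `1` elsewhere. [cite: Balaban1985BackgroundPropagators, p.412 l.1–9, bookkeeping] -/
def gapW (ρ : ℝ) (s : BlkCubeY i c) : ℝ := if nearInd i c s = 1 then Real.exp (-(ρ * (((toKT i).Mh : ℝ) / 2))) else 1
set_option maxHeartbeats 400000 in
/-- `0 ≤ Ψ_ρ ≤ 1` for `ρ ≥ 0`. [cite: Balaban1985BackgroundPropagators, p.412, bookkeeping] -/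
theorem gapW_nonneg_le_one {ρ : ℝ} (hρ : 0 ≤ ρ) (s : BlkCubeY i c) : 0 ≤ gapW i c ρ s ∧ gapW i c ρ s ≤ 1 := by
  unfold gapW
  split_ifs
  · refine ⟨Real.exp_nonneg _, Real.exp_le_one_iff.mpr ?_⟩
    have hM : (0 : ℝ) ≤ ((toKT i).Mh : ℝ) := by positivity
    have : 0 ≤ ρ * (((toKT i).Mh : ℝ) / 2) := by positivity
    linarith
  · exact ⟨zero_le_one, le_rfl⟩

/-- `Ψ_ρ = e^{−ρM_h/2}` on a block meeting `NearC 2S_j`. [cite: Balaban1985BackgroundPropagators, p.412, bookkeeping] -/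
theorem gapW_eq_of_near {ρ : ℝ} {x : SiteY i} (hx : NearC i c (2 * SC i c) x.1) : gapW i c ρ (blkCubeY i c x) = Real.exp (-(ρ * (((toKT i).Mh : ℝ) / 2))) := by
  unfold gapW; rw [if_pos (nearInd_eq_one i c hx)]

/-- ★ **FOLDING THE `M`-GAP INTO A ROW WEIGHT**: `1_T(a′)·e^{−ρd(a,a′)} ≤ Ψ_ρ(a)` for `ρ ≥ 0`. [cite: Balaban1985BackgroundPropagators, p.412 l.1–9; Balaban1984PropagatorsII, (2.46) p.231] -/
theorem kernel_gap_fold {ρ : ℝ} (hρ : 0 ≤ ρ) (a a' : BlkCubeY i c) : transInd i c a' * Real.exp (-(ρ * (geoCK i c).dist a a')) ≤ gapW i c ρ a := by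
  have hd0 := (geoCK_dist_axioms i c (0 : ℝ) True).1 a a'
  have hT := transInd_nonneg_le_one i c a'
  have hexp1 : Real.exp (-(ρ * (geoCK i c).dist a a')) ≤ 1 := Real.exp_le_one_iff.mpr (by nlinarith)
  by_cases hT1 : transInd i c a' = 1
  · rw [hT1, one_mul]
    unfold gapW
    split_ifs with hN
    · exact Real.exp_le_exp.mpr (by nlinarith [gap_dist_of_near_of_trans i c hN hT1])
    · exact hexp1
  · have hT0 : transInd i c a' = 0 := by
      have h01 : transInd i c a' = 0 ∨ transInd i c a' = 1 := by unfold transInd; split_ifs <;> simp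
      rcases h01 with h | h
      · exact h
      · exact absurd h hT1
    rw [hT0, zero_mul]
    exact (gapW_nonneg_le_one i c hρ a).1

/-- ★★ **`conj b(η²G′_□·(1 − M_χ²)·η²G′_□) ≺ B_f²M₂Σ‖b‖Cc₁·ℓ(a)²Ψ_{δ/2}(a)ℓ(a)²·e^{−(1−α′)(1−a₀)(δ/2)d}`** — the middle indicator folded into `Ψ_{δ/2}(a)` at half the rate,
then [4] (2.52) with the scale transfer of `ℓ²` at rate `δ/2`. [cite: Balaban1984PropagatorsII, (2.52) p.232, (2.60)–(2.61) p.234; Balaban1985BackgroundPropagators, p.412 l.1–9, (3.42) p.397] -/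
theorem hasMajorant_G_oneSubSq_G (Rr : ℝ) (H : Prop) (par : SiteParY 𝔸 i) (V : CfgY 𝔸 i) {M₂ : ℝ} (hM₂ : 0 ≤ M₂)
    (hrepr : ∀ (v : 𝔸) (j : ι), |b.repr v j| ≤ M₂ * ‖v‖) {δ Bf a₀ α' C : ℝ} (dB : ℕ)
    (hδ : 0 ≤ δ) (hBf : 0 ≤ Bf) (hC : 0 ≤ C) (ha₀ : 0 ≤ a₀ * (δ / 2)) (hα'0 : 0 ≤ α') (hα'1 : α' ≤ 1) (hδ' : 0 ≤ (1 - a₀) * (δ / 2))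
    (hST : ScaleTransfer (geoCK i c) (δ / 2) a₀ C (fun a => (geoCK i c).len a ^ 2)) (h261 : Ineq261 dB (toB6 (geoCK i c) Rr H) ((1 - a₀) * (δ / 2)) α')
    (hG : HasMajorant (g := toB6 (geoCK i c) Rr H) (fun p : SiteY i × ι => blkCubeY i c p.1)
      (conj b (((kGeo i).eta ^ 2) • (GpCubeY i c par V).restrictScalars ℝ))
      (fun a a' => Bf * (geoCK i c).len a ^ 2 * Real.exp (-(δ * (geoCK i c).dist a a')))) :
    HasMajorant (g := toB6 (geoCK i c) Rr H) (fun p : SiteY i × ι => blkCubeY i c p.1)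
      (conj b ((((kGeo i).eta ^ 2) • (GpCubeY i c par V).restrictScalars ℝ) *
        ((1 - cutMulY (chiY i c) * cutMulY (chiY i c) : Module.End ℂ (SiteY i → 𝔸)).restrictScalars ℝ) *
        (((kGeo i).eta ^ 2) • (GpCubeY i c par V).restrictScalars ℝ)))
      (fun a a' => Bf * (M₂ * ∑ j, ‖b j‖) * Bf * C * B6.c1 dB ((1 - a₀) * (δ / 2)) α' *
        ((geoCK i c).len a ^ 2 * gapW i c (δ / 2) a * (geoCK i c).len a ^ 2) * Real.exp (-((1 - α') * ((1 - a₀) * (δ / 2)) * (geoCK i c).dist a a'))) := by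
  obtain ⟨hdnn, htri, -, -⟩ := geoCK_dist_axioms i c Rr H
  have hSb : 0 ≤ ∑ j, ‖b j‖ := Finset.sum_nonneg fun _ _ => norm_nonneg _
  -- the left factor at half the rate with the gap weight on its row
  have hL : HasMajorant (g := toB6 (geoCK i c) Rr H) (fun p : SiteY i × ι => blkCubeY i c p.1)
      (conj b ((((kGeo i).eta ^ 2) • (GpCubeY i c par V).restrictScalars ℝ) *
        ((1 - cutMulY (chiY i c) * cutMulY (chiY i c) : Module.End ℂ (SiteY i → 𝔸)).restrictScalars ℝ)))
      (fun a a' => Bf * (M₂ * ∑ j, ‖b j‖) * ((geoCK i c).len a ^ 2 * gapW i c (δ / 2) a) * Real.exp (-(δ / 2 * (geoCK i c).dist a a'))) := by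
    refine hasMajorant_mono (g := toB6 (geoCK i c) Rr H) _ (hasMajorant_G_oneSubSq i c b Rr H par V hM₂ hrepr hG) fun a a' => ?_
    have hsplit : Real.exp (-(δ * (geoCK i c).dist a a')) = Real.exp (-(δ / 2 * (geoCK i c).dist a a')) * Real.exp (-(δ / 2 * (geoCK i c).dist a a')) := by
      rw [← Real.exp_add]; ring_nf
    have hfold := kernel_gap_fold i c (ρ := δ / 2) (by linarith) a a'
    have hpre : 0 ≤ Bf * (M₂ * ∑ j, ‖b j‖) * (geoCK i c).len a ^ 2 * Real.exp (-(δ / 2 * (geoCK i c).dist a a')) := by positivity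
    calc Bf * (geoCK i c).len a ^ 2 * Real.exp (-(δ * (geoCK i c).dist a a')) * (transInd i c a' * (M₂ * ∑ j, ‖b j‖))
        = Bf * (M₂ * ∑ j, ‖b j‖) * (geoCK i c).len a ^ 2 * Real.exp (-(δ / 2 * (geoCK i c).dist a a')) *
            (transInd i c a' * Real.exp (-(δ / 2 * (geoCK i c).dist a a'))) := by rw [hsplit]; ring
      _ ≤ Bf * (M₂ * ∑ j, ‖b j‖) * (geoCK i c).len a ^ 2 * Real.exp (-(δ / 2 * (geoCK i c).dist a a')) * gapW i c (δ / 2) a :=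
          mul_le_mul_of_nonneg_left hfold hpre
      _ = _ := by ring
  -- the right factor weakened to half the rate
  have hR : HasMajorant (g := toB6 (geoCK i c) Rr H) (fun p : SiteY i × ι => blkCubeY i c p.1)
      (conj b (((kGeo i).eta ^ 2) • (GpCubeY i c par V).restrictScalars ℝ))
      (fun a a' => Bf * (geoCK i c).len a ^ 2 * Real.exp (-(δ / 2 * (geoCK i c).dist a a'))) := by
    refine hasMajorant_mono (g := toB6 (geoCK i c) Rr H) _ hG fun a a' => ?_
    refine mul_le_mul_of_nonneg_left (Real.exp_le_exp.mpr ?_) (by positivity)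
    nlinarith [hdnn a a']
  rw [B9Eq352DivFormLetters.conj_mul]
  exact hasMajorant_mul_weighted (g := geoCK i c) (R := Rr) (H := H) (fun p : SiteY i × ι => blkCubeY i c p.1) dB
    (fun a => (geoCK i c).len a ^ 2 * gapW i c (δ / 2) a) (fun a => (geoCK i c).len a ^ 2) (mul_nonneg hBf (mul_nonneg hM₂ hSb)) hBf hC
    (fun a => mul_nonneg (sq_nonneg _) (gapW_nonneg_le_one i c (by linarith) a).1) (fun a => sq_nonneg _) ha₀ hα'0 hα'1 hδ' htri hdnn hST h261 hL hR

end Kernels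

end Literature.MathematicalPhysics.QuantumFieldTheory.Balaban1983to89.B9ThmDCubeSideKernels

end
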